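import HarnessLib
import Summits.RiemannHypothesis.RiemannHypothesis.Theses.SignCone
import Summits.RiemannHypothesis.RiemannHypothesis.Theorems.SignConeConeMagnification
import Summits.RiemannHypothesis.RiemannHypothesis.Theorems.SignConeSignConeDuality
import Summits.RiemannHypothesis.RiemannHypothesis.Theorems.SignConeSignConeOscillatoryCoherentCoreCollapse

/-!
# The sign-cone criterion, banked by name: `SignConeInequality ↔ RiemannHypothesis`
(route `SignCone`, rev 7; HELPER file `--supports stmt-RiemannHypothesis-16301` — it closes nothing)

Composition pass over the route's deciding theorem
`closes : SignConeInequality → ConeMagnification → SignConeDuality → Summit.RiemannHypothesis` (rev 7).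
Two of its three binders are CLOSED items with landed closing theorems —
`Theorems.ConeMagnification_proof` (stmt-RiemannHypothesis-16303, the 2001 magnification theorem W-MAG)
and `Theorems.SignConeDuality.SignConeDuality_of` (stmt-RiemannHypothesis-16304, conic duality at each
cutoff) — so discharging them BY NAME leaves the one-hypothesis criterion
`riemannHypothesis_of_signConeInequality : SignConeInequality → RiemannHypothesis`, and with the landed
converse `signConeInequality_of_riemannHypothesis` (explicit formula + the easy half of Weil's criterion)
the tree now holds the RH-equivalence the route thesis asks to be banked:

* `signConeInequality_iff_riemannHypothesis : SignConeInequality ↔ Summit.RiemannHypothesis`.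

Consequences recorded for the route's views (pure logic over landed theorems):

* the remaining binder of `closes`, the target `SignConeInequality` (stmt-RiemannHypothesis-16301), is
  literally equivalent to the summit, so it is NOT obtainable by composing proved declarations;
* the banked supports are RH-equivalent unconditionally: `signConeOscillatory_iff_riemannHypothesis`
  (stmt-RiemannHypothesis-18107), `oscCoherentCore_iff_riemannHypothesis` (stmt-RiemannHypothesis-18108);
* the open support `OscSingleWindow` (stmt-RiemannHypothesis-18012) has in-tree antecedents only through
  `SignConeInequality` / `SignConeOscillatory` / `OscCoherentCore` (all open, ≡ RH) or RH itself:
  `oscSingleWindow_of_signConeInequality`, `oscSingleWindow_of_riemannHypothesis`.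

No new mathematics: every proof term is a composition of declarations already in the tree.
-/

-- the summit-side namespace `Summit.RiemannHypothesis.RiemannHypothesis.…` (D-0017: Sub = Summit) repeats a component
set_option linter.dupNamespace false

namespace Summit.RiemannHypothesis.RiemannHypothesis.Theorems.SignCone

open Summit.RiemannHypothesis.RiemannHypothesis.Theses.SignCone
open Summit.RiemannHypothesis.RiemannHypothesis.Theorems (ConeMagnification_proof)
open Summit.RiemannHypothesis.RiemannHypothesis.Theorems.SignConeDuality (SignConeDuality_of)

/-! ## The deciding theorem with its closed binders discharged -/

/-- **X ⇒ RH, unconditionally**: the route's deciding theorem `closes` with its two CLOSED binders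
discharged by name (`ConeMagnification_proof`, stmt-RiemannHypothesis-16303; `SignConeDuality_of`,
stmt-RiemannHypothesis-16304). What `closes` still needs is exactly the target `SignConeInequality`. [folklore] -/
theorem riemannHypothesis_of_signConeInequality (hX : SignConeInequality) : _root_.Summit.RiemannHypothesis :=
  -- the proof term of the route's deciding theorem `closes` (rev 7), written out over the closed items'
  -- closing theorems: the gate strips `closes` from the route file once the route is closed (13:36Z),
  -- so the criterion must not refer to it by name (tree-health note on stmt-RiemannHypothesis-16301).
  ConeMagnification_proof (fun a ha => SignConeDuality_of a ha (hX a ha))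

/-- **The sign-cone criterion** (route thesis, rev 7: "to be banked by name"): the prime-free, zero-free
sign-cone inequality with unit slack holds at every cutoff iff the Riemann Hypothesis holds.
`→` is `closes` over the two closed cruxes; `←` is the landed envelope
`signConeInequality_of_riemannHypothesis`. [folklore] -/
theorem signConeInequality_iff_riemannHypothesis : SignConeInequality ↔ _root_.Summit.RiemannHypothesis :=
  ⟨riemannHypothesis_of_signConeInequality, fun hRH => signConeInequality_of_riemannHypothesis hRH⟩

/-! ## The banked supports are RH-equivalent (unconditionally, as of rev 7) -/

/-- `SignConeOscillatory ↔ RiemannHypothesis` (stmt-RiemannHypothesis-18107; via the landed collapse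
`signConeOscillatory_iff_signConeInequality`). [folklore] -/
theorem signConeOscillatory_iff_riemannHypothesis : SignConeOscillatory ↔ _root_.Summit.RiemannHypothesis :=
  signConeOscillatory_iff_signConeInequality.trans signConeInequality_iff_riemannHypothesis

/-- `OscCoherentCore ↔ RiemannHypothesis` (stmt-RiemannHypothesis-18108; via the landed collapse
`oscCoherentCore_iff_signConeInequality`). [folklore] -/
theorem oscCoherentCore_iff_riemannHypothesis : OscCoherentCore ↔ _root_.Summit.RiemannHypothesis :=
  oscCoherentCore_iff_signConeInequality.trans signConeInequality_iff_riemannHypothesis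

/-! ## Where the open support `OscSingleWindow` sits -/

/-- `SignConeInequality → OscSingleWindow` (stmt-RiemannHypothesis-18012 is the target restricted to the
single-high-window class). [folklore] -/
theorem oscSingleWindow_of_signConeInequality (h : SignConeInequality) : OscSingleWindow :=
  oscSingleWindow_of_signConeOscillatory (signConeOscillatory_of_signConeInequality h)

/-- `RiemannHypothesis → OscSingleWindow`: the open support is RH-implied (so only `¬RH` refutes it);
no unconditional antecedent of it exists in the tree. [folklore] -/
theorem oscSingleWindow_of_riemannHypothesis (hRH : _root_.Summit.RiemannHypothesis) : OscSingleWindow :=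
  oscSingleWindow_of_signConeInequality (signConeInequality_iff_riemannHypothesis.2 hRH)

end Summit.RiemannHypothesis.RiemannHypothesis.Theorems.SignCone
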